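import Mathlib
import HarnessLib

/-!
# Dual Riemann data (the linear algebra of the dual polarisation)

Let `V = ℝ^κ` with its standard pairing `⟪x, y⟫ = ∑ xᵢ yᵢ` (so that `V` is identified with its own
dual), let `J₁` be a complex structure on `V` (`J₁² = -1`) and let `J₂ = -J₁ᵀ` be minus its adjoint
(`⟪J₂ x, y⟫ = -⟪x, J₁ y⟫`), i.e. the complex structure induced on the dual space. Suppose `B₁` is
*Riemann data* for `J₁`: a real alternating `J₁`-invariant bilinear form with `B₁(x, J₁ x) > 0` for
`x ≠ 0`, rational on the standard basis. Then the INVERSE Gram matrix is Riemann data for `J₂`: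
`B₂(x, y) = xᵀ S⁻¹ y` (`S` the Gram matrix of `B₁`) is alternating, `J₂`-invariant, satisfies
`B₂(J₂ x, x) > 0` for `x ≠ 0`, and is rational on the standard basis
(`exists_dualRiemannData`).

This is the linear algebra behind the *dual polarisation* of a polarised abelian variety
(Lange–Birkenhake, *Complex Abelian Varieties*, §2.5.1, Prop. 2.5.1: the analytic representation
of `ψ_L = d₁ d_g φ_L⁻¹ : X̂ → X` is the hermitian form `d₁ d_g · c₁(L)⁻¹`, which is positive definite,
so it defines a polarisation `L_δ` of `X̂`): a polarisation of the weight-one Hodge structure on the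
COHOMOLOGY lattice `H¹(T; ℤ) = Λ^∨` of a complex torus `T = V/Λ` (complex structure `-J_Λᵀ`) yields
a Riemann form on the PERIOD lattice `Λ` itself (complex structure `J_Λ`). It is used in this form by
`Literature/AlgebraicGeometry/HodgeTheory/ComplexTorusProjectiveRiemannForm.lean` (row INFRA-05-4 of
the `pub-hodgecm2` cell: a projective complex torus admits a Riemann form).

Proof (all in matrices for the standard basis): with `S` the Gram matrix of `B₁` and `j₁`, `j₂` the
matrices of `J₁`, `J₂`: `j₂ᵀ = -j₁` (from the adjointness), `j₁ᵀ S j₁ = S` (invariance) and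
`j₁² = -1` give `S j₁ = -j₁ᵀ S = j₂ S`; `S` is invertible because `B₁` is alternating and
`B₁(x, J₁ x) > 0` (non-degenerate); hence `U := S⁻¹` intertwines, `U j₂ = j₁ U`, and
`B₂(x, y) := B₁(U y, U x) = xᵀ S⁻¹ y` inherits alternation and invariance, is positive because
`B₂(J₂ x, x) = B₁(U x, J₁ (U x))`, and is rational because `S⁻¹` is the image of the inverse of the
rational Gram matrix.

Everything here is proved; Mathlib has the matrix/bilinear-form dictionary
(`LinearMap.BilinForm.toMatrix'`, `Matrix.toBilin'`, `Matrix.nonsing_inv`) but no notion of Riemann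
form / complex torus, which is why the statement is phrased in coordinates.

## References

* H. Lange, Ch. Birkenhake, *Complex Abelian Varieties*, Grundlehren 302, Springer (1992),
  §2.5.1 «The dual polarization», Prop. 2.5.1. [LangeBirkenhake1992]
-/

namespace Literature.LinearAlgebra

open _root_.Matrix

/-- **Dual Riemann data** (the dual polarisation in coordinates). Let `J₁, J₂` be endomorphisms of
`ℝ^κ` with `J₁² = -1` and `⟪J₂ x, y⟫ = -⟪x, J₁ y⟫` for the standard pairing (so `J₂ = -J₁ᵀ`), and
let `B₁` be a real bilinear form which is alternating, `J₁`-invariant, with `B₁(x, J₁ x) > 0` for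
`x ≠ 0` and with rational values on the standard basis. Then there is a real bilinear form `B₂`
which is alternating, `J₂`-invariant, with `B₂(J₂ x, x) > 0` for `x ≠ 0` and with rational values
on the standard basis — namely `B₂(x, y) = xᵀ S⁻¹ y` for the Gram matrix `S` of `B₁`
(Lange–Birkenhake: the dual polarisation has hermitian form `d₁ d_g · c₁(L)⁻¹`).
[cite: LangeBirkenhake1992, §2.5.1 Prop. 2.5.1] -/
theorem exists_dualRiemannData {κ : Type*} [Fintype κ] [DecidableEq κ]
    (J₁ J₂ : (κ → ℝ) →ₗ[ℝ] (κ → ℝ))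
    (hJ₁ : ∀ a, J₁ (J₁ a) = -a)
    (hadj : ∀ x y : κ → ℝ, dotProduct (J₂ x) y = -dotProduct x (J₁ y))
    (B₁ : LinearMap.BilinForm ℝ (κ → ℝ)) (h0 : ∀ x, B₁ x x = 0)
    (hinv : ∀ x y, B₁ (J₁ x) (J₁ y) = B₁ x y) (hpos : ∀ x, x ≠ 0 → 0 < B₁ x (J₁ x))
    (hrat : ∀ i j, ∃ q : ℚ, B₁ (Pi.single i 1) (Pi.single j 1) = q) :
    ∃ B₂ : LinearMap.BilinForm ℝ (κ → ℝ), (∀ x, B₂ x x = 0) ∧ (∀ x y, B₂ (J₂ x) (J₂ y) = B₂ x y) ∧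
      (∀ x, x ≠ 0 → 0 < B₂ (J₂ x) x) ∧
      (∀ i j, ∃ q : ℚ, B₂ (Pi.single i 1) (Pi.single j 1) = q) := by
  classical
  -- Gram matrix of `B₁` and the matrices of `J₁`, `J₂` in the standard basis.
  set S : Matrix κ κ ℝ := LinearMap.BilinForm.toMatrix' B₁ with hSdef
  set j₁ : Matrix κ κ ℝ := LinearMap.toMatrix' J₁ with hj₁def
  set j₂ : Matrix κ κ ℝ := LinearMap.toMatrix' J₂ with hj₂def
  have hB : ∀ x y, B₁ x y = x ⬝ᵥ S *ᵥ y := fun x y => by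
    rw [← Matrix.toBilin'_apply', hSdef, Matrix.toBilin'_toMatrix']
  have hj₁v : ∀ x, J₁ x = j₁ *ᵥ x := fun x => by rw [hj₁def, LinearMap.toMatrix'_mulVec]
  have hj₂v : ∀ x, J₂ x = j₂ *ᵥ x := fun x => by rw [hj₂def, LinearMap.toMatrix'_mulVec]
  -- `j₁² = -1`
  have hj₁sq : j₁ * j₁ = -1 := by
    have h : J₁ ∘ₗ J₁ = -LinearMap.id := LinearMap.ext fun a => by simp [hJ₁]
    rw [hj₁def, ← LinearMap.toMatrix'_comp, h, map_neg, LinearMap.toMatrix'_id]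
  -- `J₁`-invariance: `j₁ᵀ S j₁ = S`
  have hinvM : j₁ᵀ * S * j₁ = S := by
    have h : B₁.comp J₁ J₁ = B₁ := LinearMap.ext fun x => LinearMap.ext fun y => by
      simp only [LinearMap.BilinForm.comp_apply, hinv]
    rw [hSdef, hj₁def, ← LinearMap.BilinForm.toMatrix'_comp, h]
  -- hence `S j₁ = -j₁ᵀ S`
  have hSj : S * j₁ = -(j₁ᵀ * S) := by
    calc S * j₁ = j₁ᵀ * S * j₁ * j₁ := by rw [hinvM]
      _ = j₁ᵀ * S * (j₁ * j₁) := by rw [Matrix.mul_assoc]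
      _ = -(j₁ᵀ * S) := by rw [hj₁sq, mul_neg, mul_one]
  -- adjointness: `j₂ᵀ = -j₁`, so `j₂ = -j₁ᵀ` and `j₂ S = S j₁`
  have hj₂T : j₂ᵀ = -j₁ := by
    apply Matrix.toBilin'.injective
    refine LinearMap.ext fun x => LinearMap.ext fun y => ?_
    rw [Matrix.toBilin'_apply', Matrix.toBilin'_apply', Matrix.mulVec_transpose, dotProduct_comm x,
      ← Matrix.dotProduct_mulVec, ← hj₂v, dotProduct_comm y (J₂ x), hadj, hj₁v, Matrix.neg_mulVec,
      dotProduct_neg]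
  have hj₂ : j₂ = -j₁ᵀ := by
    rw [← Matrix.transpose_transpose j₂, hj₂T, Matrix.transpose_neg]
  have hjS : j₂ * S = S * j₁ := by rw [hj₂, hSj, Matrix.neg_mul]
  -- `S` is invertible: `B₁` is alternating (hence reflexive) and `B₁(x, J₁ x) > 0` for `x ≠ 0`.
  have hSdet : IsUnit S.det := by
    have hnd : (Matrix.toBilin' S).Nondegenerate := by
      rw [hSdef, Matrix.toBilin'_toMatrix']
      refine (LinearMap.IsAlt.isRefl h0).nondegenerate_iff_separatingLeft.mpr fun x hx => ?_
      by_contra hne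
      have h := hpos x hne
      rw [hx] at h
      exact lt_irrefl _ h
    exact isUnit_iff_ne_zero.mpr
      (LinearMap.BilinForm.nondegenerate_toBilin'_iff_det_ne_zero.mp hnd)
  set T : Matrix κ κ ℝ := S⁻¹ with hTdef
  have hST : S * T = 1 := Matrix.mul_nonsing_inv S hSdet
  have hTS : T * S = 1 := Matrix.nonsing_inv_mul S hSdet
  -- the intertwiner `U = S⁻¹`: `T j₂ = j₁ T`
  have hTj : T * j₂ = j₁ * T := by
    calc T * j₂ = T * j₂ * (S * T) := by rw [hST, Matrix.mul_one]
      _ = T * (j₂ * S) * T := by simp only [Matrix.mul_assoc]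
      _ = T * (S * j₁) * T := by rw [hjS]
      _ = T * S * j₁ * T := by simp only [Matrix.mul_assoc]
      _ = j₁ * T := by rw [hTS, Matrix.one_mul]
  set U : (κ → ℝ) →ₗ[ℝ] (κ → ℝ) := Matrix.toLin' T with hUdef
  have hU : ∀ x, U (J₂ x) = J₁ (U x) := fun x => by
    rw [hUdef, Matrix.toLin'_apply, Matrix.toLin'_apply, hj₂v, hj₁v, Matrix.mulVec_mulVec,
      Matrix.mulVec_mulVec, hTj]
  have hUinj : ∀ x, U x = 0 → x = 0 := fun x hx => by
    rw [hUdef, Matrix.toLin'_apply] at hx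
    calc x = (S * T) *ᵥ x := by rw [hST, Matrix.one_mulVec]
      _ = 0 := by rw [← Matrix.mulVec_mulVec, hx, Matrix.mulVec_zero]
  -- the dual form `B₂(x, y) = B₁(U y, U x) = xᵀ S⁻¹ y`
  set B₂ : LinearMap.BilinForm ℝ (κ → ℝ) := B₁.flip.compl₁₂ U U with hB₂def
  have hB₂ : ∀ x y, B₂ x y = B₁ (U y) (U x) := fun x y => by
    rw [hB₂def, LinearMap.compl₁₂_apply, LinearMap.BilinForm.flip_apply]
  have hB₂' : ∀ x y, B₂ x y = x ⬝ᵥ T *ᵥ y := fun x y => by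
    rw [hB₂, hB, hUdef, Matrix.toLin'_apply, Matrix.toLin'_apply, Matrix.mulVec_mulVec, hST,
      Matrix.one_mulVec, dotProduct_comm]
  -- rationality of `S⁻¹`
  choose q hq using hrat
  set Sq : Matrix κ κ ℚ := Matrix.of fun i j => q i j with hSqdef
  have hSq : S = Sq.map (Rat.castHom ℝ) := by
    ext i j
    rw [hSdef, LinearMap.BilinForm.toMatrix'_apply, hq, Matrix.map_apply, hSqdef, Matrix.of_apply,
      Rat.coe_castHom]
  have hSqdet : IsUnit Sq.det := by
    refine isUnit_iff_ne_zero.mpr fun h => hSdet.ne_zero ?_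
    rw [hSq, ← RingHom.mapMatrix_apply, ← RingHom.map_det, h, map_zero]
  have hTq : T = (Sq⁻¹).map (Rat.castHom ℝ) := by
    rw [hTdef, hSq]
    refine Matrix.inv_eq_left_inv ?_
    rw [← Matrix.map_mul, Matrix.nonsing_inv_mul Sq hSqdet,
      Matrix.map_one _ (map_zero _) (map_one _)]
  refine ⟨B₂, fun x => ?_, fun x y => ?_, fun x hx => ?_, fun i j => ⟨Sq⁻¹ i j, ?_⟩⟩
  · rw [hB₂, h0]
  · rw [hB₂, hB₂, hU, hU, hinv]
  · rw [hB₂, hU]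
    exact hpos _ fun h => hx (hUinj x h)
  · rw [hB₂', ← Matrix.toBilin'_apply', Matrix.toBilin'_single, hTq, Matrix.map_apply,
      Rat.coe_castHom]

end Literature.LinearAlgebra
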